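import Summits.QuantumFields.YangMills.Theorems.BalabanUVNodesN16HolderMSSlotWindow
import Literature.MathematicalPhysics.QuantumFieldTheory.Balaban1983to89.Node00.Record13

/-!
# Route «BalabanUVNodes», cluster K4 «SpineRates» — node N16 = NE3: THE R-β″ (MULTI-SCALE HÖLDER) CONJUNCT IN A K3 SKELETON's TUPLE CURRENCY, PROVISO-GENERIC EDITION —
# for a tuple reading `rr : (F : T4Family) → (θ : Stage13Params F N) → P F θ → (ℕ → ℝ) → List (ULoop F) → RateCarriers N` over an ARBITRARY proviso predicate `P`, pinned at
# RR-1's NE3 object of record, the MS β-conjunct «`∀ F θ (hP : P F θ), (Rg F θ →) θ.Admissible F N → ∀ g₀ os, N16HolderMSAt (rr …).ne3 β`» is ONE `N16HolderMSAt` per family;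
# N21's MS-face; MS ⇒ β; ★ THE MS N16 LINE — every record edition (‴ `Provisos₁₃`, ⁗ `Provisos₁₃Sep`, Core `Provisos₁₃Core`, ⁵ `Provisos₁₃SepMixed`, …) is an instance by unification

Cell `pub-ymgap`, seat `pub-ymgap-dag-n16-e` (R134 acceleration seat (a), strategy s2 = BY-NAME KNIT at the record; HUMAN RULING D-0062; chair R424 venue), generation 7,
module 29ᴳ (THEOREMS ONLY, 0 `def`, 0 `sorry`, standard axioms) = the `P`-generalisation of module 29Sep `…N16HolderMSAtTupleReading13Sep` §1 (p507163; its §2 at dag-n22-e's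
NAMED reading of record is edition-bound and is re-keyed separately).  `--kind proof --supports stmt-QuantumFields-20292 --as helper` (K3⁗; KEY-20 word pending).
`bears_on: R4∕N16 · edge N05 → N16 · out-edge N16 → N21`.  Over this seat's (F2-MS) `…N16HolderMSSlotWindow` (p499974: the STAGE-FREE per-family lemma
`inEndRegimeHMS_and_leafSlotHolderMS_ofRecord_of_window_linear`; through it (E2-MS) `…N16HolderMSLeafSlot`'s closer `n16HolderMSAt_of_inEndRegimeHMS_leafSlotHolderMS`, (E1-MS)
`radiusOfRecordHMS` ∕ `constOfRecordHMS`, dag-n16-c's `…N16HolderMSDefs` (`N16HolderMSAt`, `CovRootHolderMS`, `n16HolderAt_of_n16HolderMSAt`), RR-1's `Node00/RateRecord11NE3Data`)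
and node00-def-T's `Node00/Record13.lean` (`Stage13Params`, `Admissible` — NO proviso structure is named in a statement below).  Companion of module 21ᴳ `…N16AtTupleReading13Generic`
(β = 1 and R-β currencies); see its header for WHY the proviso slot is a variable (plan g67 CORE-YES l.17420: item texts `SepMixed`-keyed, consumer storeys `Core`-keyed — one
generic module serves both binders verbatim, and a Core-keyed reading read at an item tuple `fun F θ hP => rrC F θ hP.toCore` is again of this shape with `hpin` inherited).

CONTENT (`hpin`-generic, `P`-generic, `N`-generic).
§1 — `n16HolderMS_tupleReading_iff_ofRecord`, `n16HolderMS_tupleReadingOn_iff_ofRecord` (regime `Rg F θ` inside), `covRootHolderMS_tupleReading_ofRecord` (N21's MS-face: the `h` of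
  dag-n16-c's `closeness_of_covRootHolderMS`), `n16Holder_tupleReading_of_n16HolderMS` (MS ⇒ β, block factor RR-1's), ★ `n16HolderMS_tupleReading_ofRecord_of_window_linear` ∕
  ★ `n16HolderMS_tupleReadingOn_ofRecord_of_window_linear` (THE MS N16 LINE: N05's `Thm4Body` ∕ `Prop3Body` on the univ sub-family of `zdGF3 (M_N ℂ) F.L β (len F)` with the MS
  length letter `len F (j • e μ) = j` + N07's `LeafH3sup`, once per family carrying an admissible (guarded) tuple with proviso `P`; thresholds `radiusOfRecordHMS` ∕ `constOfRecordHMS`).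

HONEST FRAMING.  Kernel bookkeeping by name; no estimate; N05's `Thm4Body` ∕ `Prop3Body` ([Balaban1985RegularSpaces] Thm 4 ∕ Prop 3 TYPES) and N07's `LeafH3sup`
([Balaban1985Variational] Thm 1 (8)+(10) TYPE) are HYPOTHESES asserted for no family; `N16HolderMSAt · β` is dag-n16-c's CANDIDATE wording for R-β″ (UNRULED; nothing of record
edited); the tuple reading `rr` and the proviso `P` are PARAMETERS; no admissible Stage-13 tuple with ANY proviso is claimed to exist (K0 OPEN at every edition); nothing of
Bałaban's asserted; **N16 ∕ NE3 is NOT discharged**; count-neutral (typed 28∕28 · discharged 5∕27, A 5∕28 UNMOVED); one finite four-torus at fixed ε — NOT ℝ⁴, NOT infinite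
volume, NOT OS, NOT a mass gap, NOT Clay.  No decl below carries a cite tag (all `[folklore]` bookkeeping).
-/


set_option autoImplicit false

open scoped BigOperators Matrix Matrix.Norms.L2Operator
open NormedSpace

namespace Summit.QuantumFields.YangMills.BalabanUVNodes.N16HolderMSAtTupleReading13Generic

open Literature.MathematicalPhysics.QuantumFieldTheory.Balaban1983to89
open Literature.MathematicalPhysics.QuantumFieldTheory.Balaban1983to89.T4Continuum (T4Family ULoop)
open B7Prop1Explicit B7Prop2Explicit
open B7Prop3Flat (c3)
open B8LeafModelZd (ZdIdx)
open B8LeafModelZd3 (zdGF3)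
open Node00 (Stage13Params NE3Objects₁₁ NE3Letters₁₁ ne3LOfRecord₁₁ ne3ConstLayerOfRecord₁₁ ne3NperOfRecord₁₁ ne3DomOfRecord₁₁ two_le_ne3LOfRecord₁₁)
open Summit.QuantumFields.BalabanUV.T4Continuum
open MinimalActionRate (sfClass)
open BlockAverageCurrent (curConst)
open NE3RightInverseSupLetters (frameC)
open NE3.LeafIndexSockets (LeafH3sup)
open YMDAG.UVSplit (NE3Carriers RateCarriers ne3OfRecord₁₁)
open Summit.QuantumFields.YangMills.BalabanUVNodes.N16HolderDefs (N16HolderAt)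
open Summit.QuantumFields.YangMills.BalabanUVNodes.N16HolderMSDefs (CovRootHolderMS N16HolderMSAt n16HolderAt_of_n16HolderMSAt)
open Summit.QuantumFields.YangMills.BalabanUVNodes.N16HolderMSRegime (radiusOfRecordHMS constOfRecordHMS)
open Summit.QuantumFields.YangMills.BalabanUVNodes.N16HolderMSLeafSlot (n16HolderMSAt_of_inEndRegimeHMS_leafSlotHolderMS)
open Summit.QuantumFields.YangMills.BalabanUVNodes.N16HolderMSSlotWindow (inEndRegimeHMS_and_leafSlotHolderMS_ofRecord_of_window_linear)

noncomputable section

variable {N : ℕ} [NeZero N] {P : (F : T4Family) → Stage13Params F N → Prop}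
  (rr : (F : T4Family) → (θ : Stage13Params F N) → P F θ → (ℕ → ℝ) → List (ULoop F) → RateCarriers N)
  (Rg : (F : T4Family) → Stage13Params F N → Prop) (ℓ : T4Family → NE3Letters₁₁) (β : ℝ)

/-! ## §1 `hpin`-generic, `P`-generic: the MS β-conjunct of a tuple reading pinned at RR-1's object of record -/

section OfRecord

variable (hpin : ∀ (F : T4Family) (θ : Stage13Params F N) (hP : P F θ) (g₀ : ℕ → ℝ) (os : List (ULoop F)),
    (rr F θ hP g₀ os).ne3 = ne3OfRecord₁₁ F (ne3ConstLayerOfRecord₁₁ F N (ℓ F)))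
include hpin

/-- **THE MS β-CONJUNCT OF A PINNED TUPLE READING IS ONE `N16HolderMSAt … β` PER FAMILY CARRYING AN ADMISSIBLE TUPLE WITH PROVISO `P`** (unguarded binder shape of the
plan's `KeyedRates`; ANY proviso predicate `P`). [folklore] -/
theorem n16HolderMS_tupleReading_iff_ofRecord :
    (∀ (F : T4Family) (θ : Stage13Params F N) (hP : P F θ), θ.Admissible F N →
        ∀ (g₀ : ℕ → ℝ) (os : List (ULoop F)), N16HolderMSAt (rr F θ hP g₀ os).ne3 β) ↔
      ∀ (F : T4Family), (∃ θ : Stage13Params F N, P F θ ∧ θ.Admissible F N) →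
        N16HolderMSAt (ne3OfRecord₁₁ F (ne3ConstLayerOfRecord₁₁ F N (ℓ F))) β := by
  constructor
  · rintro h F ⟨θ, hP, hθ⟩
    have h' := h F θ hP hθ (fun _ => 0) []
    rwa [hpin] at h'
  · intro h F θ hP hθ g₀ os
    rw [hpin]
    exact h F ⟨θ, hP, hθ⟩

/-- **THE SAME WITH A REGIME `Rg F θ` INSIDE THE BINDER** (the guarded prefix, e.g. RR-2's `unityNondeg₁₃`). [folklore] -/
theorem n16HolderMS_tupleReadingOn_iff_ofRecord :
    (∀ (F : T4Family) (θ : Stage13Params F N) (hP : P F θ), Rg F θ → θ.Admissible F N →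
        ∀ (g₀ : ℕ → ℝ) (os : List (ULoop F)), N16HolderMSAt (rr F θ hP g₀ os).ne3 β) ↔
      ∀ (F : T4Family), (∃ θ : Stage13Params F N, P F θ ∧ Rg F θ ∧ θ.Admissible F N) →
        N16HolderMSAt (ne3OfRecord₁₁ F (ne3ConstLayerOfRecord₁₁ F N (ℓ F))) β := by
  constructor
  · rintro h F ⟨θ, hP, hRg, hθ⟩
    have h' := h F θ hP hRg hθ (fun _ => 0) []
    rwa [hpin] at h'
  · intro h F θ hP hRg hθ g₀ os
    rw [hpin]
    exact h F ⟨θ, hP, hRg, hθ⟩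

/-- **N21's MS-FACE AT THE TUPLE READING**: under the MS β-conjunct, at every family with an admissible tuple with proviso `P` the MS β-root `CovRootHolderMS` at
RR-1's period, letters `ℓ F` and data `ne3DomOfRecord₁₁ F N 0 0` — the `h` of dag-n16-c's `N16HolderMSDefs.closeness_of_covRootHolderMS`. [folklore] -/
theorem covRootHolderMS_tupleReading_ofRecord
    (h : ∀ (F : T4Family) (θ : Stage13Params F N) (hP : P F θ), θ.Admissible F N →
      ∀ (g₀ : ℕ → ℝ) (os : List (ULoop F)), N16HolderMSAt (rr F θ hP g₀ os).ne3 β)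
    (F : T4Family) {θ : Stage13Params F N} (hP : P F θ) (hθ : θ.Admissible F N) :
    CovRootHolderMS 4 (sfClass 4 (ne3LOfRecord₁₁ F) (ne3NperOfRecord₁₁ F 0 0) (ℓ F).ε) (ne3LOfRecord₁₁ F) (ne3NperOfRecord₁₁ F 0 0) (ℓ F).b (ℓ F).g (ℓ F).C
      (ℓ F).Λ₁ (ℓ F).Λ₂' β (ne3DomOfRecord₁₁ F N 0 0) :=
  (n16HolderMS_tupleReading_iff_ofRecord rr ℓ β hpin).1 h F ⟨θ, hP, hθ⟩

/-- **MS ⇒ β AT THE TUPLE READING**: the MS β-conjunct implies the β-conjunct of module 21ᴳ §3 (dag-n16-c's `n16HolderAt_of_n16HolderMSAt`; the block factor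
`ne3LOfRecord₁₁ F ≥ 2 ≥ 1` is RR-1's). [folklore] -/
theorem n16Holder_tupleReading_of_n16HolderMS
    (h : ∀ (F : T4Family) (θ : Stage13Params F N) (hP : P F θ), θ.Admissible F N →
      ∀ (g₀ : ℕ → ℝ) (os : List (ULoop F)), N16HolderMSAt (rr F θ hP g₀ os).ne3 β) :
    ∀ (F : T4Family) (θ : Stage13Params F N) (hP : P F θ), θ.Admissible F N →
      ∀ (g₀ : ℕ → ℝ) (os : List (ULoop F)), N16HolderAt (rr F θ hP g₀ os).ne3 β := by
  intro F θ hP hθ g₀ os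
  have hMS := h F θ hP hθ g₀ os
  rw [hpin] at hMS ⊢
  exact n16HolderAt_of_n16HolderMSAt hMS (le_trans one_le_two (two_le_ne3LOfRecord₁₁ F))

variable (hβ0 : 0 ≤ β) (hβ1 : β ≤ 1)
  -- N05's constants, per family (MS length letter); the averaging letter in N05's window and N07's leaf letters, per family (module 26's STAGE-FREE per-family lemma, verbatim)
  {len : T4Family → Site 4 → ℝ} {c₁ c₁' B₁' cP C₂ B₀β : T4Family → ℝ} {inp : T4Family → B8.B9Inputs} {α b' c' : T4Family → ℝ}
  (hlen : ∀ (F : T4Family) (v : Site 4), 0 < len F v → 1 ≤ len F v) (hlenj : ∀ (F : T4Family) (μ : Fin 4) (j : ℕ), len F (j • e μ) = j)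
  (hB₁' : ∀ F, 0 < B₁' F) (hBB : ∀ F : T4Family, 5 * ((4 : ℕ) : ℝ) * F.L * (inp F).B₀ ≤ B₁' F) (hc₁' : ∀ F, 0 < c₁' F)
  (hwin : ∀ (F : T4Family) (α₀ α₁ : ℝ), 0 < α₀ → 0 < α₁ → α₀ + α₁ ≤ c₁' F →
    α₀ + α₁ ≤ c₁ F ∧ C0 4 * (2 * α₀) ≤ 1 / 3 ∧ 4 * α₀ ≤ c2' 4 F.L ∧ 16 * (B₁' F * (α₀ + α₁)) ≤ 1 ∧
    Real.exp (4 * (800 * (((4 : ℕ) : ℝ) + 1) ^ 2 * (((4 : ℕ) : ℝ) + 4)) * α₀) * (1 + 8 * (131072 * (((4 : ℕ) : ℝ) + 1) ^ 2) * (B₁' F * (α₀ + α₁))) ≤ 2 ∧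
    2 * (B₁' F * (α₀ + α₁)) ≤ c3 4 F.L ∧ ((4 : ℕ) : ℝ) * F.L * α₁ ≤ 1 / 8 ∧ α₀ ≤ cP F ∧ α₁ ≤ cP F ∧ B₁' F * (α₀ + α₁) ≤ cP F ∧
    2 * (B₁' F * (α₀ + α₁)) ^ 2 + 20 * ((4 : ℕ) : ℝ) * α₀ * (B₁' F * (α₀ + α₁)) + 2 * C₂ F * (B₁' F * (α₀ + α₁)) ^ 2 ≤ α₀ + α₁)
  (hα : ∀ F, 0 < α F) (hα1 : ∀ F, α F ≤ c₁' F / 177)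
  (hα2 : ∀ F : T4Family, α F ≤ (ℓ F).Λ₁ / (1770 * (5 * ((4 : ℕ) : ℝ) * F.L * (inp F).B₀) + 1))
  (hα3 : ∀ F : T4Family, α F ≤ c2' 4 F.L / 2)
  (hα4 : ∀ F : T4Family, α F ≤ 1 / ((23040 * (4 : ℝ) ^ 4 * (frameC 4 F.L + 4) ^ 3 + 12) * (1 + curConst 4 F.L) + 1))
  (hα5 : ∀ F, α F ≤ 1 / 10 ^ 9)
  (hg : ∀ F, 0 < (ℓ F).g) (hε0 : ∀ F, 0 < (ℓ F).ε) (hε : ∀ F, (ℓ F).ε < α F)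
  (hΛ₁r : ∀ F : T4Family, (ℓ F).Λ₁ ≤ radiusOfRecordHMS N F.L (ne3NperOfRecord₁₁ F 0 0))
  (hb : ∀ F, 0 ≤ (ℓ F).b ∧ (ℓ F).b ≤ (ℓ F).ε / 2) (hC : ∀ F : T4Family, constOfRecordHMS N F.L (ne3NperOfRecord₁₁ F 0 0) (ℓ F).g ≤ (ℓ F).C)
  (hΛ₂' : ∀ F : T4Family, 177 * α F * (5 * ((4 : ℕ) : ℝ) * F.L * B₀β F + 5 * ((4 : ℕ) : ℝ) * F.L * (inp F).B₀) ≤ (ℓ F).Λ₂')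
  (hb' : ∀ F, 0 ≤ b' F ∧ b' F ≤ α F / 2048) (hc' : ∀ F, 0 ≤ c' F ∧ c' F ≤ α F / 24)
include hβ0 hβ1 hlen hlenj hB₁' hBB hc₁' hwin hα hα1 hα2 hα3 hα4 hα5 hg hε0 hε hΛ₁r hb hC hΛ₂' hb' hc'

/-- ★ **THE MS N16 LINE IN THE K3 TUPLE CURRENCY, ANY PROVISO `P`, UNGUARDED** — for ANY `P`-keyed tuple reading `rr` pinned at RR-1's object with windowed letters `ℓ F`, the three content
clauses ONCE per family carrying an admissible tuple with proviso `P` give the MS β-conjunct «`∀ F θ (hP : P F θ), θ.Admissible F N → ∀ g₀ os, N16HolderMSAt (rr F θ hP g₀ os).ne3 β`»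
(module 26's STAGE-FREE `inEndRegimeHMS_and_leafSlotHolderMS_ofRecord_of_window_linear` per family, module 25's closer). [folklore] -/
theorem n16HolderMS_tupleReading_ofRecord_of_window_linear
    (hcontent : ∀ (F : T4Family), (∃ θ : Stage13Params F N, P F θ ∧ θ.Admissible F N) →
      letI : CStarAlgebra (Matrix (Fin N) (Fin N) ℂ) := {}
      B8.Thm4Body (c₁ F) (B₁' F) (fun i : {i : ZdIdx 4 F.L // i.Ω 0 = Set.univ} => (zdGF3 (Matrix (Fin N) (Fin N) ℂ) F.L β (len F) i.1).toGFData) ∧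
        B8.Prop3Body (cP F) 4 (F.L : ℝ) (C₂ F) (inp F) (B₀β F)
          (fun i : {i : ZdIdx 4 F.L // i.Ω 0 = Set.univ} => (zdGF3 (Matrix (Fin N) (Fin N) ℂ) F.L β (len F) i.1).toGFData2) ∧
        LeafH3sup 4 F.L (ne3NperOfRecord₁₁ F 0 0) (ℓ F).ε (b' F) (c' F) (ne3DomOfRecord₁₁ F N 0 0)) :
    ∀ (F : T4Family) (θ : Stage13Params F N) (hP : P F θ), θ.Admissible F N →
      ∀ (g₀ : ℕ → ℝ) (os : List (ULoop F)), N16HolderMSAt (rr F θ hP g₀ os).ne3 β :=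
  (n16HolderMS_tupleReading_iff_ofRecord rr ℓ β hpin).2 fun F hF =>
    have h := inEndRegimeHMS_and_leafSlotHolderMS_ofRecord_of_window_linear ℓ hlen hlenj hB₁' hBB hc₁' hwin hα hα1 hα2 hα3 hα4 hα5 hg hε0 hε hΛ₁r hb hC hΛ₂' hb' hc' F
      (hcontent F hF).1 (hcontent F hF).2.1 (hcontent F hF).2.2
    n16HolderMSAt_of_inEndRegimeHMS_leafSlotHolderMS h.1 hβ0 hβ1 h.2

/-- ★ **THE MS N16 LINE IN THE K3 TUPLE CURRENCY, ANY PROVISO `P`, GUARDED θ-FORM** (regime `Rg F θ` inside the binder; content asked only of GUARDED families). [folklore] -/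
theorem n16HolderMS_tupleReadingOn_ofRecord_of_window_linear
    (hcontent : ∀ (F : T4Family), (∃ θ : Stage13Params F N, P F θ ∧ Rg F θ ∧ θ.Admissible F N) →
      letI : CStarAlgebra (Matrix (Fin N) (Fin N) ℂ) := {}
      B8.Thm4Body (c₁ F) (B₁' F) (fun i : {i : ZdIdx 4 F.L // i.Ω 0 = Set.univ} => (zdGF3 (Matrix (Fin N) (Fin N) ℂ) F.L β (len F) i.1).toGFData) ∧
        B8.Prop3Body (cP F) 4 (F.L : ℝ) (C₂ F) (inp F) (B₀β F)
          (fun i : {i : ZdIdx 4 F.L // i.Ω 0 = Set.univ} => (zdGF3 (Matrix (Fin N) (Fin N) ℂ) F.L β (len F) i.1).toGFData2) ∧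
        LeafH3sup 4 F.L (ne3NperOfRecord₁₁ F 0 0) (ℓ F).ε (b' F) (c' F) (ne3DomOfRecord₁₁ F N 0 0)) :
    ∀ (F : T4Family) (θ : Stage13Params F N) (hP : P F θ), Rg F θ → θ.Admissible F N →
      ∀ (g₀ : ℕ → ℝ) (os : List (ULoop F)), N16HolderMSAt (rr F θ hP g₀ os).ne3 β :=
  (n16HolderMS_tupleReadingOn_iff_ofRecord rr Rg ℓ β hpin).2 fun F hF =>
    have h := inEndRegimeHMS_and_leafSlotHolderMS_ofRecord_of_window_linear ℓ hlen hlenj hB₁' hBB hc₁' hwin hα hα1 hα2 hα3 hα4 hα5 hg hε0 hε hΛ₁r hb hC hΛ₂' hb' hc' F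
      (hcontent F hF).1 (hcontent F hF).2.1 (hcontent F hF).2.2
    n16HolderMSAt_of_inEndRegimeHMS_leafSlotHolderMS h.1 hβ0 hβ1 h.2

end OfRecord


end

end Summit.QuantumFields.YangMills.BalabanUVNodes.N16HolderMSAtTupleReading13Generic
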